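import Summits.CriticalPhenomena.PercolationContinuityZ3.Theorems.PercNearOneGluingNoHeavyLowerTailSahiHubCorner
import Mathlib.Tactic.Linarith
import Mathlib.Tactic.Ring
import Mathlib.Tactic.LinearCombination
import HarnessLib

/-!
# `NoHeavyLowerTail` (crux stmt-CriticalPhenomena-4575), P2 — THE CERTIFICATE FRAME FOR THE HUB-CORNER FORM `q₁`
# (abstract co-shared block): `q₁ = Σ_b wB·Φ(b) + CP + R` for arbitrary ratios, `CP ≥ 0`, and `q₁ ≥ 0` from a certificate

Memo `FROM-prim-masterthm-p2-g30-CORNER-POLARISATION.md` §3, SAHI-ROUTE.md §4.57 (seat `prim-masterthm-p2`, gen 30;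
`--supports stmt-CriticalPhenomena-4575`).  No `sorry`, no named facts, standard axioms.  Companion of `…SahiHubCorner`
(`cornerQ1`, `sahiE_three_nonneg_T1_of_corner`: T₁ for EVERY finite FKG co-shared block `γ` follows from `q₀ ≥ 0 ∧ q₁ ≥ 0`).

SETTING as in `…SahiHubCorner`: `f z c a, g z c b, h z a b` (`z ∈ Fin 2` the hub, `c ∈ γ` the co-shared block, `a ∈ α, b ∈ β`
FKG blocks).  ORIENTATION "pattern `g`, fibre `b`, slices over `α`" (the class-T orientation of `…SahiTriangleClassT`, now with
two levels): at level `z`, `Y_z(c,b) = E_a[f_z(c,a)h_z(a,b)]` (`SahiTriangleClassT.Y wA (f z) (h z)`), `H_z(b)`, `F_z(c)`,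
`𝒢_z(b) = E_c g_z(c,b)` (`GG`), `G_z(c) = E_b g_z` (`GC`), `Ȳ_z(c)`, `H̄_z`, `Ḡ_z`.
PARAMETERS (all functions of `c`, free): own ratios `ρ z c`, cross coefficients `lam z c` (`𝒢_{1−z}` against `Y_z`… see below),
parallel coefficients `par z c`, and scalars `αc, βc, κ1, κ0`.

* `PhiC` — the FIBRE FUNCTION
  `Φ(b) = E_c[g₁(2−ρ₁)Y₁ + g₀(2−ρ₀)Y₀](b) − 𝒢₁(b)·{αc·H₁(b) + E_c[lam₀Y₀ + par₁Y₁](b) − κ1} − 𝒢₀(b)·{βc·H₀(b) + E_c[lam₁Y₁ + par₀Y₀](b) − κ0}`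
  (written as a combination of fibre atoms);
* `CPC` — the COVARIANCE PART (FKG on `β`), `RC` — the ENVIRONMENT REMAINDER (means only), memo §3;
* `cornerQ1_eq_certificate` — **THE IDENTITY** `q₁ = Σ_b wB Φ(b) + CPC + RC` (needs only `Σ wA = Σ wB = Σ wC = 1`);
* `CPC_nonneg` — `CPC ≥ 0` for `ρ, lam, par ≥ 0`, `αc ≥ F̄₀`, `βc ≥ F̄₁` (FKG on `β`, monotone nonnegative data);
* `fkg_sum_shift`, `twoLevel_fkg_lemma` — **THE TWO-LEVEL FKG LEMMA** (memo §3): monotone minorants `θ_z ≤ K_z` with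
  `E_cθ₁ ≥ A₁`, `E_c(θ₀+θ₁) ≥ A₀+A₁` give `E_c[p₁K₁ + p₀K₀] ≥ 𝒫₁A₁ + 𝒫₀A₀` for patterns `0 ≤ p₀ ≤ p₁` — the tool that
  discharges `Φ(b) ≥ 0` fibre by fibre for a general FKG block;
* `cornerQ1_nonneg_of_certificate` — **CERTIFICATE FORM**: such parameters with `Φ(b) ≥ 0` at every fibre and `RC ≥ 0` give
  `q₁ ≥ 0`.  Memo §4: a certificate of exactly this shape (plus monotone-minorant bookkeeping at the fibres) exists in 100 % of
  ≈ 600 sampled cells on chains, grids, cubes and non-product FKG squares; the closed-form rule is open.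
(The corner-0 form `q₀` is the same statement for the level-reversed data; not repeated here.) [this work]
-/

noncomputable section

open scoped Classical

namespace Summit.CriticalPhenomena.PercolationContinuityZ3.Theorems

namespace SahiHubCorner

open Finset Literature.Combinatorics.Sahi2008
open SahiTriangleClassT (Y FC HH GG GC Ybar Hbar Gbar expectations)
open SahiTriangleSupermodular (fkg_sum)

section CertDefs

variable {α β γ : Type} [Fintype α] [Fintype β] [Fintype γ]
  (wA : α → ℝ) (wB : β → ℝ) (wC : γ → ℝ)
  (f : Fin 2 → γ → α → ℝ) (g : Fin 2 → γ → β → ℝ) (h : Fin 2 → α → β → ℝ)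
  (ρ lam par : Fin 2 → γ → ℝ) (αc βc κ1 κ0 : ℝ)

/-- The FIBRE FUNCTION `Φ(b)` of the Q-polarisation certificate (memo §3), as a combination of fibre atoms. [this work] -/
def PhiC (b : β) : ℝ :=
  2 * (∑ c, wC c * (g 1 c b * Y wA (f 1) (h 1) c b)) - (∑ c, wC c * (ρ 1 c * (g 1 c b * Y wA (f 1) (h 1) c b)))
  + 2 * (∑ c, wC c * (g 0 c b * Y wA (f 0) (h 0) c b)) - (∑ c, wC c * (ρ 0 c * (g 0 c b * Y wA (f 0) (h 0) c b)))
  - GG wC (g 1) b * (∑ c, wC c * (lam 0 c * Y wA (f 0) (h 0) c b)) - GG wC (g 1) b * (∑ c, wC c * (par 1 c * Y wA (f 1) (h 1) c b))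
  - GG wC (g 0) b * (∑ c, wC c * (lam 1 c * Y wA (f 1) (h 1) c b)) - GG wC (g 0) b * (∑ c, wC c * (par 0 c * Y wA (f 0) (h 0) c b))
  - αc * (GG wC (g 1) b * HH wA (h 1) b) + κ1 * GG wC (g 1) b
  - βc * (GG wC (g 0) b * HH wA (h 0) b) + κ0 * GG wC (g 0) b

/-- Mean of the first member at level `z`: `F̄_z = E_c F_z(c)`. [this work] -/
def Fb (z : Fin 2) : ℝ := ∑ c, wC c * FC wA (f z) c
/-- `𝔜_z = E_c Ȳ_z(c) = E(f_z h_z)`. [this work] -/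
def YY (z : Fin 2) : ℝ := ∑ c, wC c * Ybar wA wB (f z) (h z) c
/-- `E_c[F_z(c) G_z(c)] = E(f_z g_z)`. [this work] -/
def FG (z : Fin 2) : ℝ := ∑ c, wC c * (FC wA (f z) c * GC wB (g z) c)

/-- The COVARIANCE PART `CP` (memo §3), in atom form:
`E_c[ρ₁Cov_b(g₁,Y₁) + ρ₀Cov_b(g₀,Y₀) + lam₀Cov_b(𝒢₁,Y₀) + par₁Cov_b(𝒢₁,Y₁) + lam₁Cov_b(𝒢₀,Y₁) + par₀Cov_b(𝒢₀,Y₀)] + (αc−F̄₀)Cov_b(𝒢₁,H₁) + (βc−F̄₁)Cov_b(𝒢₀,H₀)`. [this work] -/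
def CPC : ℝ :=
  (∑ c, wC c * (ρ 1 c * ∑ b, wB b * (g 1 c b * Y wA (f 1) (h 1) c b)))
    - (∑ c, wC c * (ρ 1 c * (GC wB (g 1) c * Ybar wA wB (f 1) (h 1) c)))
  + (∑ c, wC c * (ρ 0 c * ∑ b, wB b * (g 0 c b * Y wA (f 0) (h 0) c b)))
    - (∑ c, wC c * (ρ 0 c * (GC wB (g 0) c * Ybar wA wB (f 0) (h 0) c)))
  + (∑ c, wC c * (lam 0 c * ∑ b, wB b * (GG wC (g 1) b * Y wA (f 0) (h 0) c b)))
    - Gbar wB wC (g 1) * (∑ c, wC c * (lam 0 c * Ybar wA wB (f 0) (h 0) c))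
  + (∑ c, wC c * (par 1 c * ∑ b, wB b * (GG wC (g 1) b * Y wA (f 1) (h 1) c b)))
    - Gbar wB wC (g 1) * (∑ c, wC c * (par 1 c * Ybar wA wB (f 1) (h 1) c))
  + (∑ c, wC c * (lam 1 c * ∑ b, wB b * (GG wC (g 0) b * Y wA (f 1) (h 1) c b)))
    - Gbar wB wC (g 0) * (∑ c, wC c * (lam 1 c * Ybar wA wB (f 1) (h 1) c))
  + (∑ c, wC c * (par 0 c * ∑ b, wB b * (GG wC (g 0) b * Y wA (f 0) (h 0) c b)))
    - Gbar wB wC (g 0) * (∑ c, wC c * (par 0 c * Ybar wA wB (f 0) (h 0) c))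
  + (αc - Fb wA wC f 0) * ((∑ b, wB b * (GG wC (g 1) b * HH wA (h 1) b)) - Gbar wB wC (g 1) * Hbar wA wB (h 1))
  + (βc - Fb wA wC f 1) * ((∑ b, wB b * (GG wC (g 0) b * HH wA (h 0) b)) - Gbar wB wC (g 0) * Hbar wA wB (h 0))

/-- The ENVIRONMENT REMAINDER `R` (memo §3; means only), in atom form.  `R = E_c[G₁r₁ + G₀r₀]` with
`r₁(c) = ρ₁Ȳ₁(c) − H̄₀F₁(c) − E_c[(1−lam₀)Ȳ₀] + E_c[par₁Ȳ₁] + (αc−F̄₀)H̄₁ − κ1 + H̄₁F̄₀ − F̄₁(H̄₁−H̄₀)`,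
`r₀(c) = ρ₀Ȳ₀(c) − H̄₁F₀(c) − E_c[(1−lam₁)Ȳ₁] + E_c[par₀Ȳ₀] + (βc−F̄₁)H̄₀ − κ0 + H̄₁F̄₁`. [this work] -/
def RC : ℝ :=
  (∑ c, wC c * (ρ 1 c * (GC wB (g 1) c * Ybar wA wB (f 1) (h 1) c)))
  + (∑ c, wC c * (ρ 0 c * (GC wB (g 0) c * Ybar wA wB (f 0) (h 0) c)))
  - Gbar wB wC (g 1) * (YY wA wB wC f h 0 - ∑ c, wC c * (lam 0 c * Ybar wA wB (f 0) (h 0) c))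
  + Gbar wB wC (g 1) * (∑ c, wC c * (par 1 c * Ybar wA wB (f 1) (h 1) c))
  - Gbar wB wC (g 0) * (YY wA wB wC f h 1 - ∑ c, wC c * (lam 1 c * Ybar wA wB (f 1) (h 1) c))
  + Gbar wB wC (g 0) * (∑ c, wC c * (par 0 c * Ybar wA wB (f 0) (h 0) c))
  + (αc - Fb wA wC f 0) * (Gbar wB wC (g 1) * Hbar wA wB (h 1)) + (βc - Fb wA wC f 1) * (Gbar wB wC (g 0) * Hbar wA wB (h 0))
  - κ1 * Gbar wB wC (g 1) - κ0 * Gbar wB wC (g 0)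
  - Hbar wA wB (h 0) * FG wA wB wC f g 1 - Hbar wA wB (h 1) * FG wA wB wC f g 0
  + Hbar wA wB (h 1) * (Fb wA wC f 0 * Gbar wB wC (g 1) + Fb wA wC f 1 * Gbar wB wC (g 0) - Fb wA wC f 1 * Gbar wB wC (g 1))
  + Fb wA wC f 1 * Gbar wB wC (g 1) * Hbar wA wB (h 0)

end CertDefs

section CertIdentity

variable {α β γ : Type} [Fintype α] [Fintype β] [Fintype γ]
  {wA : α → ℝ} {wB : β → ℝ} {wC : γ → ℝ}
  {f : Fin 2 → γ → α → ℝ} {g : Fin 2 → γ → β → ℝ} {h : Fin 2 → α → β → ℝ}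
  {ρ lam par : Fin 2 → γ → ℝ} {αc βc κ1 κ0 : ℝ}

omit [Fintype β] in
/-- Unfolding `Φ` at one fibre. [this work] -/
theorem PhiC_apply (b : β) :
    PhiC wA wC f g h ρ lam par αc βc κ1 κ0 b =
      2 * (∑ c, wC c * (g 1 c b * Y wA (f 1) (h 1) c b)) - (∑ c, wC c * (ρ 1 c * (g 1 c b * Y wA (f 1) (h 1) c b)))
      + 2 * (∑ c, wC c * (g 0 c b * Y wA (f 0) (h 0) c b)) - (∑ c, wC c * (ρ 0 c * (g 0 c b * Y wA (f 0) (h 0) c b)))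
      - GG wC (g 1) b * (∑ c, wC c * (lam 0 c * Y wA (f 0) (h 0) c b)) - GG wC (g 1) b * (∑ c, wC c * (par 1 c * Y wA (f 1) (h 1) c b))
      - GG wC (g 0) b * (∑ c, wC c * (lam 1 c * Y wA (f 1) (h 1) c b)) - GG wC (g 0) b * (∑ c, wC c * (par 0 c * Y wA (f 0) (h 0) c b))
      - αc * (GG wC (g 1) b * HH wA (h 1) b) + κ1 * GG wC (g 1) b
      - βc * (GG wC (g 0) b * HH wA (h 0) b) + κ0 * GG wC (g 0) b := rfl

omit [Fintype β] in
/-- `Σ_{b∈s} wB Φ(b)` expanded into fibre atoms (bookkeeping). [this work] -/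
theorem sum_PhiC (s : Finset β) :
    (∑ b ∈ s, wB b * PhiC wA wC f g h ρ lam par αc βc κ1 κ0 b) =
      2 * (∑ b ∈ s, wB b * ∑ c, wC c * (g 1 c b * Y wA (f 1) (h 1) c b))
      - (∑ b ∈ s, wB b * ∑ c, wC c * (ρ 1 c * (g 1 c b * Y wA (f 1) (h 1) c b)))
      + 2 * (∑ b ∈ s, wB b * ∑ c, wC c * (g 0 c b * Y wA (f 0) (h 0) c b))
      - (∑ b ∈ s, wB b * ∑ c, wC c * (ρ 0 c * (g 0 c b * Y wA (f 0) (h 0) c b)))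
      - (∑ b ∈ s, wB b * (GG wC (g 1) b * ∑ c, wC c * (lam 0 c * Y wA (f 0) (h 0) c b)))
      - (∑ b ∈ s, wB b * (GG wC (g 1) b * ∑ c, wC c * (par 1 c * Y wA (f 1) (h 1) c b)))
      - (∑ b ∈ s, wB b * (GG wC (g 0) b * ∑ c, wC c * (lam 1 c * Y wA (f 1) (h 1) c b)))
      - (∑ b ∈ s, wB b * (GG wC (g 0) b * ∑ c, wC c * (par 0 c * Y wA (f 0) (h 0) c b)))
      - αc * (∑ b ∈ s, wB b * (GG wC (g 1) b * HH wA (h 1) b)) + κ1 * (∑ b ∈ s, wB b * GG wC (g 1) b)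
      - βc * (∑ b ∈ s, wB b * (GG wC (g 0) b * HH wA (h 0) b)) + κ0 * (∑ b ∈ s, wB b * GG wC (g 0) b) := by
  induction s using Finset.induction_on with
  | empty => simp
  | insert a s ha ih =>
    simp only [sum_insert ha]
    rw [PhiC_apply (wA := wA) (wC := wC) (f := f) (g := g) (h := h) (ρ := ρ) (lam := lam) (par := par)
      (αc := αc) (βc := βc) (κ1 := κ1) (κ0 := κ0) a]
    linear_combination ih

omit [Fintype α] in
/-- Fubini for weighted double sums with a `c`-dependent coefficient (plumbing). [folklore] -/
theorem fubini_coef (φ : γ → ℝ) (P : γ → β → ℝ) :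
    (∑ b, wB b * ∑ c, wC c * (φ c * P c b)) = ∑ c, wC c * (φ c * ∑ b, wB b * P c b) := by
  simp only [mul_sum]
  rw [sum_comm]
  exact sum_congr rfl fun c _ => sum_congr rfl fun b _ => by ring

omit [Fintype α] in
/-- Fubini with a fibre factor `G(b)` (plumbing). [folklore] -/
theorem fubini_coef_fibre (G : β → ℝ) (φ : γ → ℝ) (P : γ → β → ℝ) :
    (∑ b, wB b * (G b * ∑ c, wC c * (φ c * P c b))) = ∑ c, wC c * (φ c * ∑ b, wB b * (G b * P c b)) := by
  simp only [mul_sum]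
  rw [sum_comm]
  exact sum_congr rfl fun c _ => sum_congr rfl fun b _ => by ring

omit [Fintype α] in
/-- Fubini without coefficient (plumbing). [folklore] -/
theorem fubini_plain (P : γ → β → ℝ) :
    (∑ b, wB b * ∑ c, wC c * P c b) = ∑ c, wC c * ∑ b, wB b * P c b := by
  have := fubini_coef (wB := wB) (wC := wC) (fun _ => (1 : ℝ)) P
  simpa only [one_mul] using this

/-- The level-`z` moments of `q₁` in the slice vocabulary (`SahiTriangleClassT.expectations` at each level). [this work] -/
theorem cornerQ1_moments (hA1 : ∑ a, wA a = 1) (hB1 : ∑ b, wB b = 1) (hC1 : ∑ c, wC c = 1) :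
    cornerQ1 wA wB wC f g h =
      2 * (∑ c, wC c * ∑ b, wB b * (g 1 c b * Y wA (f 1) (h 1) c b))
      + 2 * (∑ c, wC c * ∑ b, wB b * (g 0 c b * Y wA (f 0) (h 0) c b))
      - Fb wA wC f 0 * (∑ b, wB b * (GG wC (g 1) b * HH wA (h 1) b))
      - Fb wA wC f 1 * (∑ b, wB b * (GG wC (g 0) b * HH wA (h 0) b))
      - Gbar wB wC (g 0) * YY wA wB wC f h 1 - Gbar wB wC (g 1) * YY wA wB wC f h 0
      - Hbar wA wB (h 0) * FG wA wB wC f g 1 - Hbar wA wB (h 1) * FG wA wB wC f g 0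
      - Fb wA wC f 1 * Gbar wB wC (g 1) * Hbar wA wB (h 1)
      + Fb wA wC f 0 * Gbar wB wC (g 1) * Hbar wA wB (h 1)
      + Fb wA wC f 1 * Gbar wB wC (g 0) * Hbar wA wB (h 1)
      + Fb wA wC f 1 * Gbar wB wC (g 1) * Hbar wA wB (h 0) := by
  obtain ⟨a1, a2, a3, a4, a5, a6, a7⟩ := expectations (wA := wA) (wB := wB) (wC := wC) (f := f 1) (g := g 1) (h := h 1) hA1 hB1 hC1
  obtain ⟨b1, b2, b3, b4, b5, b6, b7⟩ := expectations (wA := wA) (wB := wB) (wC := wC) (f := f 0) (g := g 0) (h := h 0) hA1 hB1 hC1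
  have e : ∀ z : Fin 2,
      exL wA wB wC z (F1 f * F2 g * F3 h) = ex (fun q : α × β × γ => wA q.1 * wB q.2.1 * wC q.2.2)
        ((fun q => f z q.2.2 q.1) * (fun q => g z q.2.2 q.2.1) * fun q => h z q.1 q.2.1) ∧
      exL wA wB wC z (F1 f * F2 g) = ex (fun q : α × β × γ => wA q.1 * wB q.2.1 * wC q.2.2)
        ((fun q => f z q.2.2 q.1) * fun q => g z q.2.2 q.2.1) ∧
      exL wA wB wC z (F1 f * F3 h) = ex (fun q : α × β × γ => wA q.1 * wB q.2.1 * wC q.2.2)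
        ((fun q => f z q.2.2 q.1) * fun q => h z q.1 q.2.1) ∧
      exL wA wB wC z (F1 f) = ex (fun q : α × β × γ => wA q.1 * wB q.2.1 * wC q.2.2) (fun q => f z q.2.2 q.1) ∧
      exL wA wB wC z (F2 g * F3 h) = ex (fun q : α × β × γ => wA q.1 * wB q.2.1 * wC q.2.2)
        ((fun q => g z q.2.2 q.2.1) * fun q => h z q.1 q.2.1) ∧
      exL wA wB wC z (F2 g) = ex (fun q : α × β × γ => wA q.1 * wB q.2.1 * wC q.2.2) (fun q => g z q.2.2 q.2.1) ∧
      exL wA wB wC z (F3 h) = ex (fun q : α × β × γ => wA q.1 * wB q.2.1 * wC q.2.2) (fun q => h z q.1 q.2.1) := by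
    intro z; refine ⟨rfl, rfl, rfl, rfl, rfl, rfl, rfl⟩
  obtain ⟨c1, c2, c3, c4, c5, c6, c7⟩ := e 1
  obtain ⟨d1, d2, d3, d4, d5, d6, d7⟩ := e 0
  unfold cornerQ1 cornerMixed
  rw [c1, c2, c3, c4, c5, c6, c7, d1, d2, d3, d4, d5, d6, d7, a1, a2, a3, a4, a5, a6, a7, b1, b2, b3, b4, b5, b6, b7]
  unfold Fb YY FG
  ring

/-- **THE CERTIFICATE IDENTITY** `q₁ = Σ_b wB·Φ(b) + CP + R` for ARBITRARY parameters `ρ, lam, par, αc, βc, κ1, κ0`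
(pure bookkeeping; needs only `Σ wA = Σ wB = Σ wC = 1`; memo §3). [this work] -/
theorem cornerQ1_eq_certificate (hA1 : ∑ a, wA a = 1) (hB1 : ∑ b, wB b = 1) (hC1 : ∑ c, wC c = 1) :
    cornerQ1 wA wB wC f g h =
      (∑ b, wB b * PhiC wA wC f g h ρ lam par αc βc κ1 κ0 b) + CPC wA wB wC f g h ρ lam par αc βc
        + RC wA wB wC f g h ρ lam par αc βc κ1 κ0 := by
  rw [cornerQ1_moments hA1 hB1 hC1, sum_PhiC]
  have r1 := fubini_plain (wB := wB) (wC := wC) (fun c b => g 1 c b * Y wA (f 1) (h 1) c b)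
  have r0 := fubini_plain (wB := wB) (wC := wC) (fun c b => g 0 c b * Y wA (f 0) (h 0) c b)
  have s1 := fubini_coef (wB := wB) (wC := wC) (ρ 1) (fun c b => g 1 c b * Y wA (f 1) (h 1) c b)
  have s0 := fubini_coef (wB := wB) (wC := wC) (ρ 0) (fun c b => g 0 c b * Y wA (f 0) (h 0) c b)
  have t1 := fubini_coef_fibre (wB := wB) (wC := wC) (GG wC (g 1)) (lam 0) (fun c b => Y wA (f 0) (h 0) c b)
  have t2 := fubini_coef_fibre (wB := wB) (wC := wC) (GG wC (g 1)) (par 1) (fun c b => Y wA (f 1) (h 1) c b)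
  have t3 := fubini_coef_fibre (wB := wB) (wC := wC) (GG wC (g 0)) (lam 1) (fun c b => Y wA (f 1) (h 1) c b)
  have t4 := fubini_coef_fibre (wB := wB) (wC := wC) (GG wC (g 0)) (par 0) (fun c b => Y wA (f 0) (h 0) c b)
  beta_reduce at r1 r0 s1 s0 t1 t2 t3 t4
  rw [r1, r0, s1, s0, t1, t2, t3, t4]
  have hg : ∀ z, (∑ b, wB b * GG wC (g z) b) = Gbar wB wC (g z) := fun z => rfl
  rw [hg 0, hg 1]
  unfold CPC RC YY
  ring

end CertIdentity

section CertPositivity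

variable {α β γ : Type} [Fintype α] [Fintype β] [Fintype γ]
  {wA : α → ℝ} {wB : β → ℝ} {wC : γ → ℝ}
  {f : Fin 2 → γ → α → ℝ} {g : Fin 2 → γ → β → ℝ} {h : Fin 2 → α → β → ℝ}
  {ρ lam par : Fin 2 → γ → ℝ} {αc βc κ1 κ0 : ℝ}

/-- **`CP ≥ 0`** for `ρ, lam, par ≥ 0`, `αc ≥ F̄₀`, `βc ≥ F̄₁` (FKG on `β`: every piece is a `b`-covariance of two monotone
nonnegative functions with a nonnegative coefficient). [this work] -/
theorem CPC_nonneg [DistribLattice β] (hB : IsFKGMeasure wB) (hA0 : ∀ a, 0 ≤ wA a) (hC0 : ∀ c, 0 ≤ wC c)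
    (hf0 : ∀ z c a, 0 ≤ f z c a) (hg0 : ∀ z c b, 0 ≤ g z c b) (hgb : ∀ z c, Monotone (g z c))
    (hh0 : ∀ z a b, 0 ≤ h z a b) (hhb : ∀ z a, Monotone (h z a))
    (hρ : ∀ z c, 0 ≤ ρ z c) (hlam : ∀ z c, 0 ≤ lam z c) (hpar : ∀ z c, 0 ≤ par z c)
    (hα : Fb wA wC f 0 ≤ αc) (hβ : Fb wA wC f 1 ≤ βc) :
    0 ≤ CPC wA wB wC f g h ρ lam par αc βc := by
  have hB0 := hB.nonneg
  -- fibre facts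
  have hY0 : ∀ z c b, 0 ≤ Y wA (f z) (h z) c b := fun z c b =>
    sum_nonneg fun a _ => mul_nonneg (hA0 a) (mul_nonneg (hf0 z c a) (hh0 z a b))
  have hYm : ∀ z c, Monotone (Y wA (f z) (h z) c) := fun z c b b' hbb =>
    sum_le_sum fun a _ => mul_le_mul_of_nonneg_left (mul_le_mul_of_nonneg_left (hhb z a hbb) (hf0 z c a)) (hA0 a)
  have hG0 : ∀ z b, 0 ≤ GG wC (g z) b := fun z b => sum_nonneg fun c _ => mul_nonneg (hC0 c) (hg0 z c b)
  have hGm : ∀ z, Monotone (GG wC (g z)) := fun z b b' hbb =>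
    sum_le_sum fun c _ => mul_le_mul_of_nonneg_left (hgb z c hbb) (hC0 c)
  have hH0 : ∀ z b, 0 ≤ HH wA (h z) b := fun z b => sum_nonneg fun a _ => mul_nonneg (hA0 a) (hh0 z a b)
  have hHm : ∀ z, Monotone (HH wA (h z)) := fun z b b' hbb =>
    sum_le_sum fun a _ => mul_le_mul_of_nonneg_left (hhb z a hbb) (hA0 a)
  -- own covariances
  have own : ∀ z c, 0 ≤ (∑ b, wB b * (g z c b * Y wA (f z) (h z) c b)) - GC wB (g z) c * Ybar wA wB (f z) (h z) c := fun z c => by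
    unfold GC Ybar
    exact sub_nonneg.2 (fkg_sum hB (hg0 z c) (hY0 z c) (hgb z c) (hYm z c))
  -- cross covariances (pattern average against a slice)
  have crs : ∀ z z' c, 0 ≤ (∑ b, wB b * (GG wC (g z) b * Y wA (f z') (h z') c b))
      - Gbar wB wC (g z) * Ybar wA wB (f z') (h z') c := fun z z' c => by
    unfold Gbar Ybar
    exact sub_nonneg.2 (fkg_sum hB (hG0 z) (hY0 z' c) (hGm z) (hYm z' c))
  have gh : ∀ z, 0 ≤ (∑ b, wB b * (GG wC (g z) b * HH wA (h z) b)) - Gbar wB wC (g z) * Hbar wA wB (h z) := fun z => by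
    unfold Gbar Hbar
    exact sub_nonneg.2 (fkg_sum hB (hG0 z) (hH0 z) (hGm z) (hHm z))
  -- regroup the atom pairs of `CPC` into weighted sums of these covariances
  have e1 : ∀ z, (∑ c, wC c * (ρ z c * ∑ b, wB b * (g z c b * Y wA (f z) (h z) c b)))
      - (∑ c, wC c * (ρ z c * (GC wB (g z) c * Ybar wA wB (f z) (h z) c)))
      = ∑ c, wC c * (ρ z c * ((∑ b, wB b * (g z c b * Y wA (f z) (h z) c b)) - GC wB (g z) c * Ybar wA wB (f z) (h z) c)) :=
    fun z => by rw [← sum_sub_distrib]; exact sum_congr rfl fun c _ => by ring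
  have e2 : ∀ (μ : γ → ℝ) z z', (∑ c, wC c * (μ c * ∑ b, wB b * (GG wC (g z) b * Y wA (f z') (h z') c b)))
      - Gbar wB wC (g z) * (∑ c, wC c * (μ c * Ybar wA wB (f z') (h z') c))
      = ∑ c, wC c * (μ c * ((∑ b, wB b * (GG wC (g z) b * Y wA (f z') (h z') c b)) - Gbar wB wC (g z) * Ybar wA wB (f z') (h z') c)) :=
    fun μ z z' => by rw [mul_sum, ← sum_sub_distrib]; exact sum_congr rfl fun c _ => by ring
  have p1 : ∀ z, 0 ≤ ∑ c, wC c * (ρ z c * ((∑ b, wB b * (g z c b * Y wA (f z) (h z) c b)) - GC wB (g z) c * Ybar wA wB (f z) (h z) c)) :=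
    fun z => sum_nonneg fun c _ => mul_nonneg (hC0 c) (mul_nonneg (hρ z c) (own z c))
  have p2 : ∀ (μ : γ → ℝ), (∀ c, 0 ≤ μ c) → ∀ z z', 0 ≤ ∑ c, wC c * (μ c * ((∑ b, wB b * (GG wC (g z) b * Y wA (f z') (h z') c b))
      - Gbar wB wC (g z) * Ybar wA wB (f z') (h z') c)) :=
    fun μ hμ z z' => sum_nonneg fun c _ => mul_nonneg (hC0 c) (mul_nonneg (hμ c) (crs z z' c))
  have q1 := p1 1; have q0 := p1 0
  have q2 := p2 (lam 0) (hlam 0) 1 0; have q3 := p2 (par 1) (hpar 1) 1 1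
  have q4 := p2 (lam 1) (hlam 1) 0 1; have q5 := p2 (par 0) (hpar 0) 0 0
  have q6 := mul_nonneg (sub_nonneg.2 hα) (gh 1); have q7 := mul_nonneg (sub_nonneg.2 hβ) (gh 0)
  rw [← e1 1] at q1; rw [← e1 0] at q0
  rw [← e2 (lam 0) 1 0] at q2; rw [← e2 (par 1) 1 1] at q3; rw [← e2 (lam 1) 0 1] at q4; rw [← e2 (par 0) 0 0] at q5
  unfold CPC
  linarith

/-- **CERTIFICATE FORM OF `q₁ ≥ 0`** (abstract co-shared block).  If for some parameters `ρ, lam, par ≥ 0`, `αc ≥ F̄₀`, `βc ≥ F̄₁`,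
`κ1, κ0` the fibre function is nonnegative at every fibre (`Φ(b) ≥ 0 ∀ b`) and the environment remainder is nonnegative (`R ≥ 0`),
then the hub-corner form `q₁` is nonnegative.  (With the analogous statement for `q₀` and `sahiE_three_nonneg_T1_of_corner` this
gives Kahn's `C₃` on T₁ for every FKG co-shared block; memo §4: such certificates exist in every sampled cell.) [this work] -/
theorem cornerQ1_nonneg_of_certificate [DistribLattice α] [DistribLattice β]
    (hA : IsFKGMeasure wA) (hB : IsFKGMeasure wB) (hC0 : ∀ c, 0 ≤ wC c) (hC1 : ∑ c, wC c = 1)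
    (hf0 : ∀ z c a, 0 ≤ f z c a) (hg0 : ∀ z c b, 0 ≤ g z c b) (hgb : ∀ z c, Monotone (g z c))
    (hh0 : ∀ z a b, 0 ≤ h z a b) (hhb : ∀ z a, Monotone (h z a))
    (hρ : ∀ z c, 0 ≤ ρ z c) (hlam : ∀ z c, 0 ≤ lam z c) (hpar : ∀ z c, 0 ≤ par z c)
    (hα : Fb wA wC f 0 ≤ αc) (hβ : Fb wA wC f 1 ≤ βc)
    (hPhi : ∀ b, 0 ≤ PhiC wA wC f g h ρ lam par αc βc κ1 κ0 b) (hR : 0 ≤ RC wA wB wC f g h ρ lam par αc βc κ1 κ0) :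
    0 ≤ cornerQ1 wA wB wC f g h := by
  rw [cornerQ1_eq_certificate (ρ := ρ) (lam := lam) (par := par) (αc := αc) (βc := βc) (κ1 := κ1) (κ0 := κ0)
    hA.sum_eq_one hB.sum_eq_one hC1]
  have h1 : 0 ≤ ∑ b, wB b * PhiC wA wC f g h ρ lam par αc βc κ1 κ0 b := sum_nonneg fun b _ => mul_nonneg (hB.nonneg b) (hPhi b)
  have h2 := CPC_nonneg (ρ := ρ) (lam := lam) (par := par) hB hA.nonneg hC0 hf0 hg0 hgb hh0 hhb hρ hlam hpar hα hβ
  linarith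

/-- Chebyshev/FKG on the block for a monotone `θ` of ANY sign against a monotone nonnegative pattern `p`
(shift `θ` by `Σ|θ|` and use `fkg_sum`; needs `Σ wC = 1`). [this work] -/
theorem fkg_sum_shift [DistribLattice γ] (hC : IsFKGMeasure wC) {p θ : γ → ℝ}
    (hp0 : ∀ c, 0 ≤ p c) (hpm : Monotone p) (hθm : Monotone θ) :
    (∑ c, wC c * p c) * (∑ c, wC c * θ c) ≤ ∑ c, wC c * (p c * θ c) := by
  set m : ℝ := ∑ c, |θ c| with hm
  have hθ' : ∀ c, 0 ≤ θ c + m := fun c => by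
    have h1 : |θ c| ≤ m := by
      rw [hm]; exact Finset.single_le_sum (f := fun c => |θ c|) (fun c _ => abs_nonneg (θ c)) (mem_univ c)
    have h2 := neg_abs_le (θ c)
    linarith
  have hmono : Monotone (fun c => θ c + m) := fun c c' hcc => by simpa using hθm hcc
  have key := fkg_sum hC hp0 hθ' hpm hmono
  have hC1 := hC.sum_eq_one
  have e1 : (∑ c, wC c * (θ c + m)) = (∑ c, wC c * θ c) + m := by
    rw [show (∑ c, wC c * (θ c + m)) = (∑ c, wC c * θ c) + (∑ c, wC c) * m from by
      rw [sum_mul, ← sum_add_distrib]; exact sum_congr rfl fun c _ => by ring, hC1, one_mul]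
  have e2 : (∑ c, wC c * (p c * (θ c + m))) = (∑ c, wC c * (p c * θ c)) + (∑ c, wC c * p c) * m := by
    rw [sum_mul, ← sum_add_distrib]; exact sum_congr rfl fun c _ => by ring
  rw [e1, e2] at key
  nlinarith [key]

/-- **THE TWO-LEVEL FKG LEMMA** (memo §3): for patterns `0 ≤ p₀ ≤ p₁` monotone on the FKG block `γ`, kernels `K_z` with monotone
minorants `θ_z ≤ K_z` such that `E_cθ₁ ≥ A₁` and `E_c(θ₀+θ₁) ≥ A₀ + A₁`, one has `E_c[p₁K₁ + p₀K₀] ≥ 𝒫₁A₁ + 𝒫₀A₀`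
(`𝒫_z = E_c p_z`).  This is how `Φ(b) ≥ 0` is discharged fibre by fibre (patterns `p_z = g_z(·,b)`, kernels `(2−ρ_z)Y_z(·,b)`,
`A_z` the braces of `PhiC`). [this work] -/
theorem twoLevel_fkg_lemma [DistribLattice γ] (hC : IsFKGMeasure wC) {p0 p1 K0 K1 θ0 θ1 : γ → ℝ} {A0 A1 : ℝ}
    (hp0 : ∀ c, 0 ≤ p0 c) (hp01 : ∀ c, p0 c ≤ p1 c) (hp0m : Monotone p0) (hp1m : Monotone p1)
    (hθK1 : ∀ c, θ1 c ≤ K1 c) (hθK0 : ∀ c, θ0 c ≤ K0 c) (hθ1m : Monotone θ1) (hθ0m : Monotone θ0)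
    (hA1 : A1 ≤ ∑ c, wC c * θ1 c) (hA01 : A0 + A1 ≤ ∑ c, wC c * (θ0 c + θ1 c)) :
    (∑ c, wC c * p1 c) * A1 + (∑ c, wC c * p0 c) * A0 ≤ ∑ c, wC c * (p1 c * K1 c + p0 c * K0 c) := by
  have hC0 := hC.nonneg
  have hp1 : ∀ c, 0 ≤ p1 c := fun c => le_trans (hp0 c) (hp01 c)
  have k1 := fkg_sum_shift hC hp1 hp1m hθ1m
  have k0 := fkg_sum_shift hC hp0 hp0m hθ0m
  have m1 : (∑ c, wC c * (p1 c * θ1 c)) ≤ ∑ c, wC c * (p1 c * K1 c) :=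
    sum_le_sum fun c _ => mul_le_mul_of_nonneg_left (mul_le_mul_of_nonneg_left (hθK1 c) (hp1 c)) (hC0 c)
  have m0 : (∑ c, wC c * (p0 c * θ0 c)) ≤ ∑ c, wC c * (p0 c * K0 c) :=
    sum_le_sum fun c _ => mul_le_mul_of_nonneg_left (mul_le_mul_of_nonneg_left (hθK0 c) (hp0 c)) (hC0 c)
  have hP0 : 0 ≤ ∑ c, wC c * p0 c := sum_nonneg fun c _ => mul_nonneg (hC0 c) (hp0 c)
  have hP01 : (∑ c, wC c * p0 c) ≤ ∑ c, wC c * p1 c := sum_le_sum fun c _ => mul_le_mul_of_nonneg_left (hp01 c) (hC0 c)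
  have esum : (∑ c, wC c * (p1 c * K1 c + p0 c * K0 c)) = (∑ c, wC c * (p1 c * K1 c)) + ∑ c, wC c * (p0 c * K0 c) := by
    rw [← sum_add_distrib]; exact sum_congr rfl fun c _ => by ring
  have eθ : (∑ c, wC c * (θ0 c + θ1 c)) = (∑ c, wC c * θ0 c) + ∑ c, wC c * θ1 c := by
    rw [← sum_add_distrib]; exact sum_congr rfl fun c _ => by ring
  rw [eθ] at hA01
  rw [esum]
  nlinarith [mul_nonneg (sub_nonneg.2 hP01) (sub_nonneg.2 hA1), mul_nonneg hP0 (sub_nonneg.2 hA01)]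

end CertPositivity

end SahiHubCorner

end Summit.CriticalPhenomena.PercolationContinuityZ3.Theorems
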